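import Summits.QuantumFields.YangMills.Theorems.ColdStartUniversalityLatticeLangevinNoiseFrame
import Summits.QuantumFields.YangMills.Theorems.ColdStartUniversalityLatticeLangevinFrameCalculus
import Summits.QuantumFields.YangMills.Theorems.ColdStartUniversalityLatticeLangevinMeasurableFlow
import Summits.QuantumFields.YangMills.Theorems.ColdStartUniversalityLatticeLangevinDynkinForward
import Literature.MathematicalPhysics.QuantumFieldTheory.SUNBakryEmeryPoincare
import Literature.MathematicalPhysics.QuantumFieldTheory.ContinuumLimitsYM2Haar
import Literature.MathematicalPhysics.QuantumLattice.TorusWilsonGibbs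
import Mathlib.MeasureTheory.Measure.Tilted
import Mathlib.Analysis.Calculus.ParametricIntegral
import HarnessLib

/-!
# Route `ColdStartUniversality` (fixed-cut-off package, Bakry–Émery side): INTEGRATION BY PARTS along the noise frame for the
# Wilson measure `μ_{β'}` of the SU(2) lattice Langevin dynamics — from Haar invariance, for `C¹` functions

Helper file (seat `ym-line-csu-p1`, g25; `--supports stmt-QuantumFields-24809`).  For the product Haar measure `π = Haar^{⊗E}` on
`SU(2)^E` (`E` = edges of `(ℤ/L)³`) and a right-invariant direction `y ↦ coords δ_e(X Q_e)` (`X ∈ 𝔰𝔲(2)`), left-invariance of `π` under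
`Q_e ↦ e^{tX} Q_e`, differentiated at `t = 0` under the integral sign, gives ★ `integral_fieldDeriv_pi_eq_zero`: `∫ (W_X H)(coords V) dπ = 0`
for every `C¹` function `H` of the real link coordinates (`W_X H(y) = DH(y)[δ_e(X·rebuild(y)_e)]`).  With `μ_{β'} = π.tilted(ψ̂∘coords + const)`
(`wilsonMeasure_eq_tilted_pi`, `ψ̂ = β'Σ_p Re tr U_p` the plaquette function of `…GradientDriftFlat`) and `H = A·B·e^{ψ̂}` this is
★★ `integral_frameDeriv_mul_wilson` — the INTEGRATION-BY-PARTS IDENTITY along the SZZ noise field `σ_n`: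
  `∫ (W_nA)·B dμ_{β'} = −∫ A·(W_nB) dμ_{β'} − ∫ A·B·(W_nψ̂) dμ_{β'}`   (`A, B ∈ C¹`),
the hypothesis `hIBP` of `…FrameBochner` (so far the tree had the symmetry of the generator only on `C³` compactly supported functions,
through the semigroup, `integral_mul_generator_symm`).  Template: `SUNBakryEmery.integral_matD_eq_zero` (one link).
THEOREMS ONLY, no definition, no sorry.  HONEST FRAMING: fixed cut-off; nothing K-uniform; no statement about the Yang–Mills mass gap.
-/

set_option autoImplicit false

noncomputable section

namespace Summit.QuantumFields.YangMills.Theorems.ColdStartUniversality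

open MeasureTheory Matrix Complex Finset Filter Topology
open scoped ComplexConjugate BigOperators Matrix
open Literature.MathematicalPhysics.QuantumFieldTheory
open Literature.MathematicalPhysics.QuantumLattice (fundamentalRep fundamentalLatticeRep continuous_fundamentalRep fundamentalRep_apply)

variable {L : ℕ} [NeZero L]

/-! ## §1. Rebuilding coordinates of a configuration; the field `δ_e(X Q_e)` in coordinates -/

omit [NeZero L] in
/-- `rebuild (coords V) = (V_e)` (as matrices). [folklore] -/
theorem rebuild_coords_of (V : (GaugeConfig 3 L (Matrix.specialUnitaryGroup (Fin 2) ℂ))) :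
    (fun (ee : Edge 3 L) => Matrix.of fun (i j : Fin (fundamentalLatticeRep 2).N) => (((fun (V : GaugeConfig 3 L (Matrix.specialUnitaryGroup (Fin 2) ℂ)) (q : Edge 3 L × Fin (fundamentalLatticeRep 2).N × Fin (fundamentalLatticeRep 2).N × Bool) => (fun z : ℂ => if q.2.2.2 then z.im else z.re) ((fundamentalRep (Fin 2) (V q.1) : Matrix (Fin 2) (Fin 2) ℂ) q.2.1 q.2.2.1)) V (ee, i, j, false) : ℝ) : ℂ) + (((fun (V : GaugeConfig 3 L (Matrix.specialUnitaryGroup (Fin 2) ℂ)) (q : Edge 3 L × Fin (fundamentalLatticeRep 2).N × Fin (fundamentalLatticeRep 2).N × Bool) => (fun z : ℂ => if q.2.2.2 then z.im else z.re) ((fundamentalRep (Fin 2) (V q.1) : Matrix (Fin 2) (Fin 2) ℂ) q.2.1 q.2.2.1)) V (ee, i, j, true) : ℝ) : ℂ) * Complex.I) = fun e => Matrix.of fun i j : Fin (fundamentalLatticeRep 2).N => (fundamentalRep (Fin 2) (V e) : Matrix (Fin 2) (Fin 2) ℂ) i j := by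
  funext e
  ext i j
  simp only [Matrix.of_apply, Bool.false_eq_true, if_false, if_true]
  exact Complex.re_add_im _

omit [NeZero L] in
/-- `rebuild` of the field `y ↦ coords δ_e(X·rebuild(y)_e)`: the matrix configuration `δ_e(X Q_e)`. [folklore] -/
theorem rebuild_field (e : Edge 3 L) (X : Matrix (Fin (fundamentalLatticeRep 2).N) (Fin (fundamentalLatticeRep 2).N) ℂ) (y : (Edge 3 L × Fin (fundamentalLatticeRep 2).N × Fin (fundamentalLatticeRep 2).N × Bool → ℝ)) :
    (fun (ee : Edge 3 L) => Matrix.of fun (i j : Fin (fundamentalLatticeRep 2).N) => (((fun q : Edge 3 L × Fin (fundamentalLatticeRep 2).N × Fin (fundamentalLatticeRep 2).N × Bool => if e = q.1 then (fun z : ℂ => if q.2.2.2 then z.im else z.re) ((X * (fun (ee : Edge 3 L) => Matrix.of fun (i j : Fin (fundamentalLatticeRep 2).N) => ((y (ee, i, j, false) : ℝ) : ℂ) + ((y (ee, i, j, true) : ℝ) : ℂ) * Complex.I) q.1) q.2.1 q.2.2.1) else 0) (ee, i, j, false) : ℝ) : ℂ) + (((fun q : Edge 3 L × Fin (fundamentalLatticeRep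 2).N × Fin (fundamentalLatticeRep 2).N × Bool => if e = q.1 then (fun z : ℂ => if q.2.2.2 then z.im else z.re) ((X * (fun (ee : Edge 3 L) => Matrix.of fun (i j : Fin (fundamentalLatticeRep 2).N) => ((y (ee, i, j, false) : ℝ) : ℂ) + ((y (ee, i, j, true) : ℝ) : ℂ) * Complex.I) q.1) q.2.1 q.2.2.1) else 0) (ee, i, j, true) : ℝ) : ℂ) * Complex.I) = fun e' => if e = e' then X * (fun (ee : Edge 3 L) => Matrix.of fun (i j : Fin (fundamentalLatticeRep 2).N) => ((y (ee, i, j, false) : ℝ) : ℂ) + ((y (ee, i, j, true) : ℝ) : ℂ) * Complex.I) e' else 0 := by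
  funext e'
  ext i j
  by_cases h : e = e'
  · simp only [Matrix.of_apply, h, if_true, Bool.false_eq_true, if_false]
    exact Complex.re_add_im _
  · simp only [Matrix.of_apply, h, if_false, Matrix.zero_apply]
    push_cast
    ring

/-- The field `y ↦ coords δ_e(X·rebuild(y)_e)` is a continuous linear map. [folklore] -/
theorem exists_field_clm (e : Edge 3 L) (X : Matrix (Fin (fundamentalLatticeRep 2).N) (Fin (fundamentalLatticeRep 2).N) ℂ) :
    ∃ T : (Edge 3 L × Fin (fundamentalLatticeRep 2).N × Fin (fundamentalLatticeRep 2).N × Bool → ℝ) →L[ℝ] (Edge 3 L × Fin (fundamentalLatticeRep 2).N × Fin (fundamentalLatticeRep 2).N × Bool → ℝ), ∀ y, T y = (fun q : Edge 3 L × Fin (fundamentalLatticeRep 2).N × Fin (fundamentalLatticeRep 2).N × Bool => if e = q.1 then (fun z : ℂ => if q.2.2.2 then z.im else z.re) ((X * (fun (ee : Edge 3 L) => Matrix.of fun (i j : Fin (fundamentalLatticeRep 2).N) => ((y (ee, i, j, false) : ℝ) : ℂ) + ((y (ee, i, j, true) : ℝ) : ℂ) * Complex.I) q.1) q.2.1 q.2.2.1)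 else 0) := by
  classical
  set reb : (Edge 3 L × Fin (fundamentalLatticeRep 2).N × Fin (fundamentalLatticeRep 2).N × Bool → ℝ) → (Edge 3 L → Matrix (Fin (fundamentalLatticeRep 2).N) (Fin (fundamentalLatticeRep 2).N) ℂ) := fun y => (fun (ee : Edge 3 L) => Matrix.of fun (i j : Fin (fundamentalLatticeRep 2).N) => ((y (ee, i, j, false) : ℝ) : ℂ) + ((y (ee, i, j, true) : ℝ) : ℂ) * Complex.I) with hreb
  set φ : (Edge 3 L × Fin (fundamentalLatticeRep 2).N × Fin (fundamentalLatticeRep 2).N × Bool → ℝ) → (Edge 3 L × Fin (fundamentalLatticeRep 2).N × Fin (fundamentalLatticeRep 2).N × Bool → ℝ) := fun y => (fun q : Edge 3 L × Fin (fundamentalLatticeRep 2).N × Fin (fundamentalLatticeRep 2).N × Bool => if e = q.1 then (fun z : ℂ => if q.2.2.2 then z.im else z.re) ((X * (fun (ee : Edge 3 L) => Matrix.of fun (i j : Fin (fundamentalLatticeRep 2).N) => ((y (ee, i, j, false) : ℝ) : ℂ) + ((y (ee, i, j, true) : ℝ) : ℂ) * Complex.I) q.1) q.2.1 q.2.2.1)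 else 0) with hφ
  have r_add : ∀ v w : (Edge 3 L × Fin (fundamentalLatticeRep 2).N × Fin (fundamentalLatticeRep 2).N × Bool → ℝ), reb (v + w) = reb v + reb w := fun v w => rebuild_add v w
  have r_smul : ∀ (a : ℝ) (v : (Edge 3 L × Fin (fundamentalLatticeRep 2).N × Fin (fundamentalLatticeRep 2).N × Bool → ℝ)), reb (a • v) = (a : ℂ) • reb v := fun a v => rebuild_smul a v
  have r_inj : ∀ v w : (Edge 3 L × Fin (fundamentalLatticeRep 2).N × Fin (fundamentalLatticeRep 2).N × Bool → ℝ), reb v = reb w → v = w := fun v w h => eq_of_rebuild_eq h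
  have r_φ : ∀ y, reb (φ y) = fun e' => if e = e' then X * reb y e' else 0 := fun y => rebuild_field e X y
  have hadd : ∀ y y', φ (y + y') = φ y + φ y' := by
    intro y y'
    refine r_inj _ _ ?_
    rw [r_add, r_φ, r_φ, r_φ, r_add]
    funext e'
    simp only [Pi.add_apply]
    split_ifs
    · rw [Matrix.mul_add]
    · rw [add_zero]
  have hsmul : ∀ (a : ℝ) y, φ (a • y) = a • φ y := by
    intro a y
    refine r_inj _ _ ?_
    rw [r_smul, r_φ, r_φ, r_smul]
    funext e'
    simp only [Pi.smul_apply]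
    split_ifs
    · rw [Matrix.mul_smul]
    · rw [smul_zero]
  let Tl : (Edge 3 L × Fin (fundamentalLatticeRep 2).N × Fin (fundamentalLatticeRep 2).N × Bool → ℝ) →ₗ[ℝ] (Edge 3 L × Fin (fundamentalLatticeRep 2).N × Fin (fundamentalLatticeRep 2).N × Bool → ℝ) := { toFun := φ, map_add' := hadd, map_smul' := hsmul }
  exact ⟨LinearMap.toContinuousLinearMap Tl, fun y => rfl⟩

/-! ## §2. The left flow `Q_e ↦ e^{sX} Q_e` read in coordinates -/

section Flow

open scoped Matrix.Norms.Operator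

/-- **Derivative along the one-parameter subgroup**: for `X ∈ 𝔰𝔲(2)` and differentiable `H`,
`d/ds H(coords(e^{sX}·_e V)) = DH(coords V_s)[coords δ_e(X (V_s)_e)]`. [folklore] -/
theorem hasDerivAt_comp_coords_leftFlow {X : Matrix (Fin (fundamentalLatticeRep 2).N) (Fin (fundamentalLatticeRep 2).N) ℂ} (hX : Xᴴ = -X) (hX0 : X.trace = 0)
    (e : Edge 3 L) (V : (GaugeConfig 3 L (Matrix.specialUnitaryGroup (Fin 2) ℂ))) {H : (Edge 3 L × Fin (fundamentalLatticeRep 2).N × Fin (fundamentalLatticeRep 2).N × Bool → ℝ) → ℝ} (hH : Differentiable ℝ H) (s : ℝ) :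
    HasDerivAt (fun s : ℝ => H ((fun (V : GaugeConfig 3 L (Matrix.specialUnitaryGroup (Fin 2) ℂ)) (q : Edge 3 L × Fin (fundamentalLatticeRep 2).N × Fin (fundamentalLatticeRep 2).N × Bool) => (fun z : ℂ => if q.2.2.2 then z.im else z.re) ((fundamentalRep (Fin 2) (V q.1) : Matrix (Fin 2) (Fin 2) ℂ) q.2.1 q.2.2.1)) (Pi.mulSingle e (SUNBakryEmery.expSU (N := 2) (Y := Matrix.of fun i j : Fin 2 => X i j) hX hX0 s) * V)))
      (fderiv ℝ H ((fun (V : GaugeConfig 3 L (Matrix.specialUnitaryGroup (Fin 2) ℂ)) (q : Edge 3 L × Fin (fundamentalLatticeRep 2).N × Fin (fundamentalLatticeRep 2).N × Bool) => (fun z : ℂ => if q.2.2.2 then z.im else z.re) ((fundamentalRep (Fin 2) (V q.1) : Matrix (Fin 2) (Fin 2) ℂ) q.2.1 q.2.2.1)) (Pi.mulSingle e (SUNBakryEmery.expSU (N := 2) (Y := Matrix.of fun i j : Fin 2 => X i j) hX hX0 s) * V))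
        ((fun q : Edge 3 L × Fin (fundamentalLatticeRep 2).N × Fin (fundamentalLatticeRep 2).N × Bool => if e = q.1 then (fun z : ℂ => if q.2.2.2 then z.im else z.re) ((X * (fun (ee : Edge 3 L) => Matrix.of fun (i j : Fin (fundamentalLatticeRep 2).N) => (((fun (V : GaugeConfig 3 L (Matrix.specialUnitaryGroup (Fin 2) ℂ)) (q : Edge 3 L × Fin (fundamentalLatticeRep 2).N × Fin (fundamentalLatticeRep 2).N × Bool) => (fun z : ℂ => if q.2.2.2 then z.im else z.re) ((fundamentalRep (Fin 2) (V q.1) : Matrix (Fin 2) (Fin 2) ℂ) q.2.1 q.2.2.1)) (Pi.mulSingle e (SUNBakryEmery.expSU (N := 2) (Y := Matrix.of fun i j : Fin 2 => X i j) hX hX0 s) * V) (ee, i, j, false) : ℝ) : ℂ) + (((fun (V : GaugeConfig 3 L (Matrix.specialUnitaryGroup (Fin 2) ℂ)) (q : Edge 3 L × Fin (fundamentalLatticeRep 2).N × Fin (fundamentalLatticeRep 2).N × Bool) => (fun z : ℂ => if q.2.2.2 then z.im else z.re) ((fundamentalRep (Fin 2) (V q.1) : Matrix (Fin 2) (Fin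 2) ℂ) q.2.1 q.2.2.1)) (Pi.mulSingle e (SUNBakryEmery.expSU (N := 2) (Y := Matrix.of fun i j : Fin 2 => X i j) hX hX0 s) * V) (ee, i, j, true) : ℝ) : ℂ) * Complex.I) q.1) q.2.1 q.2.2.1) else 0)))
      s := by
  classical
  set X2 : Matrix (Fin 2) (Fin 2) ℂ := Matrix.of fun i j : Fin 2 => X i j with hX2
  set M : Matrix (Fin 2) (Fin 2) ℂ := (fundamentalRep (Fin 2) (V e) : Matrix (Fin 2) (Fin 2) ℂ) with hM
  set co : (GaugeConfig 3 L (Matrix.specialUnitaryGroup (Fin 2) ℂ)) → (Edge 3 L × Fin (fundamentalLatticeRep 2).N × Fin (fundamentalLatticeRep 2).N × Bool → ℝ) := (fun (V : GaugeConfig 3 L (Matrix.specialUnitaryGroup (Fin 2) ℂ)) (q : Edge 3 L × Fin (fundamentalLatticeRep 2).N × Fin (fundamentalLatticeRep 2).N × Bool) => (fun z : ℂ => if q.2.2.2 then z.im else z.re) ((fundamentalRep (Fin 2) (V q.1) : Matrix (Fin 2) (Fin 2) ℂ) q.2.1 q.2.2.1)) with hco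
  set u : ℝ → (GaugeConfig 3 L (Matrix.specialUnitaryGroup (Fin 2) ℂ)) := fun s => Pi.mulSingle e (SUNBakryEmery.expSU (N := 2) (Y := Matrix.of fun i j : Fin 2 => X i j) hX hX0 s) with hu
  -- the linear map `N ↦ coords δ_e(N)`
  set Lf : Matrix (Fin 2) (Fin 2) ℂ → (Edge 3 L × Fin (fundamentalLatticeRep 2).N × Fin (fundamentalLatticeRep 2).N × Bool → ℝ) := fun N q => if e = q.1 then (fun z : ℂ => if q.2.2.2 then z.im else z.re) (N q.2.1 q.2.2.1)
    else 0 with hLf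
  have hLadd : ∀ N N', Lf (N + N') = Lf N + Lf N' := by
    intro N N'; funext q; obtain ⟨e', i, j, b⟩ := q
    rw [Pi.add_apply]
    by_cases h : e = e' <;> cases b <;> simp [hLf, h, Matrix.add_apply]
  have hLsmul : ∀ (a : ℝ) N, Lf (a • N) = a • Lf N := by
    intro a N; funext q; obtain ⟨e', i, j, b⟩ := q
    rw [Pi.smul_apply]
    by_cases h : e = e' <;> cases b <;> simp [hLf, h, Matrix.smul_apply]
  let Ll : Matrix (Fin 2) (Fin 2) ℂ →ₗ[ℝ] (Edge 3 L × Fin (fundamentalLatticeRep 2).N × Fin (fundamentalLatticeRep 2).N × Bool → ℝ) := { toFun := Lf, map_add' := hLadd, map_smul' := hLsmul }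
  let Lc : Matrix (Fin 2) (Fin 2) ℂ →L[ℝ] (Edge 3 L × Fin (fundamentalLatticeRep 2).N × Fin (fundamentalLatticeRep 2).N × Bool → ℝ) := LinearMap.toContinuousLinearMap Ll
  have hLc : ∀ N, Lc N = Lf N := fun N => rfl
  -- the constant part of the curve
  set c0 : (Edge 3 L × Fin (fundamentalLatticeRep 2).N × Fin (fundamentalLatticeRep 2).N × Bool → ℝ) := fun q => if e = q.1 then 0 else co V q with hc0
  -- the curve in coordinates
  have hcurve : ∀ s, co (u s * V) = c0 + Lc (NormedSpace.exp (s • X2) * M) := by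
    intro s
    funext q
    rw [Pi.add_apply, hLc]
    simp only [hco, hc0, hLf, hu, Pi.mul_apply]
    by_cases h : e = q.1
    · rw [if_pos h, if_pos h, zero_add, ← h, Pi.mulSingle_eq_same, map_mul, fundamentalRep_apply,
        SUNBakryEmery.coe_expSU]
    · rw [if_neg h, if_neg h, add_zero, Pi.mulSingle_eq_of_ne (Ne.symm h), one_mul]
  -- derivative of the matrix curve, pushed through `Lc`, then through `H`
  have hmat : HasDerivAt (fun s : ℝ => NormedSpace.exp (s • X2) * M) (X2 * NormedSpace.exp (s • X2) * M) s :=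
    (hasDerivAt_exp_smul_const' (𝕂 := ℝ) X2 s).mul_const M
  have hLcurve : HasDerivAt (fun s : ℝ => c0 + Lc (NormedSpace.exp (s • X2) * M)) (Lc (X2 * NormedSpace.exp (s • X2) * M)) s :=
    (Lc.hasFDerivAt.comp_hasDerivAt s hmat).const_add c0
  have hc' : HasDerivAt (fun s : ℝ => co (u s * V)) (Lc (X2 * NormedSpace.exp (s • X2) * M)) s := by
    have heq : (fun s : ℝ => co (u s * V)) = fun s => c0 + Lc (NormedSpace.exp (s • X2) * M) := funext hcurve
    rw [heq]; exact hLcurve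
  have hcomp := (hH (co (u s * V))).hasFDerivAt.comp_hasDerivAt s hc'
  -- identify the direction with the field at the current point
  have hdir : Lc (X2 * NormedSpace.exp (s • X2) * M) = (fun q : Edge 3 L × Fin (fundamentalLatticeRep 2).N × Fin (fundamentalLatticeRep 2).N × Bool => if e = q.1 then (fun z : ℂ => if q.2.2.2 then z.im else z.re) ((X * (fun (ee : Edge 3 L) => Matrix.of fun (i j : Fin (fundamentalLatticeRep 2).N) => (((co (u s * V)) (ee, i, j, false) : ℝ) : ℂ) + (((co (u s * V)) (ee, i, j, true) : ℝ) : ℂ) * Complex.I) q.1) q.2.1 q.2.2.1) else 0) := by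
    rw [hLc, rebuild_coords_of]
    funext q
    simp only [hLf]
    by_cases h : e = q.1
    · rw [if_pos h, if_pos h]
      have hq : (u s * V) q.1 = (SUNBakryEmery.expSU (N := 2) (Y := Matrix.of fun i j : Fin 2 => X i j) hX hX0 s) * V e := by
        rw [← h]; simp only [hu, Pi.mul_apply, Pi.mulSingle_eq_same]
      have hm : X2 * NormedSpace.exp (s • X2) * M =
          X * Matrix.of fun i j : Fin (fundamentalLatticeRep 2).N => (fundamentalRep (Fin 2) ((u s * V) q.1) : Matrix (Fin 2) (Fin 2) ℂ) i j := by
        rw [hq, map_mul, fundamentalRep_apply, SUNBakryEmery.coe_expSU, Matrix.mul_assoc]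
        rfl
      rw [hm]
    · rw [if_neg h, if_neg h]
  exact hcomp.congr_deriv (by rw [hdir])

omit [NeZero L] in
/-- Continuity of the left flow `(s, V) ↦ e^{sX} ·_e V`. [folklore] -/
theorem continuous_leftFlow {X : Matrix (Fin (fundamentalLatticeRep 2).N) (Fin (fundamentalLatticeRep 2).N) ℂ} (hX : Xᴴ = -X) (hX0 : X.trace = 0) (e : Edge 3 L) :
    Continuous fun p : ℝ × (GaugeConfig 3 L (Matrix.specialUnitaryGroup (Fin 2) ℂ)) => Pi.mulSingle e (SUNBakryEmery.expSU (N := 2) (Y := Matrix.of fun i j : Fin 2 => X i j) hX hX0 p.1) * p.2 := by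
  classical
  have hexp : Continuous fun s : ℝ => (SUNBakryEmery.expSU (N := 2) (Y := Matrix.of fun i j : Fin 2 => X i j) hX hX0 s) := by
    refine Continuous.subtype_mk ?_ _
    exact Literature.MathematicalPhysics.QuantumFieldTheory.continuous_exp_smul _
  exact ((continuous_mulSingle e).comp (hexp.comp continuous_fst)).mul continuous_snd

end Flow

/-! ## §3. Integration by parts for product Haar measure -/

/-- ★ **`∫ (W_X H)(coords V) dHaar^{⊗E}(V) = 0`** for `X ∈ 𝔰𝔲(2)`, a link `e` and a `C¹` function `H` of the real link coordinates,
`W_X H (y) = DH(y)[coords δ_e(X·rebuild(y)_e)]`: left invariance of product Haar measure under `Q_e ↦ e^{sX}Q_e`, differentiated at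
`s = 0` under the integral sign. [folklore] -/
theorem integral_fieldDeriv_pi_eq_zero (L : ℕ) [NeZero L] {X : Matrix (Fin (fundamentalLatticeRep 2).N) (Fin (fundamentalLatticeRep 2).N) ℂ} (hX : Xᴴ = -X) (hX0 : X.trace = 0)
    (e : Edge 3 L) {H : (Edge 3 L × Fin (fundamentalLatticeRep 2).N × Fin (fundamentalLatticeRep 2).N × Bool → ℝ) → ℝ} (hH : ContDiff ℝ 1 H) :
    ∫ V, fderiv ℝ H ((fun (V : GaugeConfig 3 L (Matrix.specialUnitaryGroup (Fin 2) ℂ)) (q : Edge 3 L × Fin (fundamentalLatticeRep 2).N × Fin (fundamentalLatticeRep 2).N × Bool) => (fun z : ℂ => if q.2.2.2 then z.im else z.re) ((fundamentalRep (Fin 2) (V q.1) : Matrix (Fin 2) (Fin 2) ℂ) q.2.1 q.2.2.1)) V) (fun q : Edge 3 L × Fin (fundamentalLatticeRep 2).N × Fin (fundamentalLatticeRep 2).N × Bool => if e = q.1 then (fun z : ℂ => if q.2.2.2 then z.im else z.re) ((X * (fun (ee : Edge 3 L) => Matrix.of fun (i j : Fin (fundamentalLatticeRep 2).N) => (((fun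 (V : GaugeConfig 3 L (Matrix.specialUnitaryGroup (Fin 2) ℂ)) (q : Edge 3 L × Fin (fundamentalLatticeRep 2).N × Fin (fundamentalLatticeRep 2).N × Bool) => (fun z : ℂ => if q.2.2.2 then z.im else z.re) ((fundamentalRep (Fin 2) (V q.1) : Matrix (Fin 2) (Fin 2) ℂ) q.2.1 q.2.2.1)) V (ee, i, j, false) : ℝ) : ℂ) + (((fun (V : GaugeConfig 3 L (Matrix.specialUnitaryGroup (Fin 2) ℂ)) (q : Edge 3 L × Fin (fundamentalLatticeRep 2).N × Fin (fundamentalLatticeRep 2).N × Bool) => (fun z : ℂ => if q.2.2.2 then z.im else z.re) ((fundamentalRep (Fin 2) (V q.1) : Matrix (Fin 2) (Fin 2) ℂ) q.2.1 q.2.2.1)) V (ee, i, j, true) : ℝ) : ℂ) * Complex.I) q.1) q.2.1 q.2.2.1) else 0)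
      ∂(Measure.pi fun _ : Edge 3 L => haarProbability (Matrix.specialUnitaryGroup (Fin 2) ℂ)) = 0 := by
  classical
  haveI := secondCountableTopology_su2
  haveI := borelSpace_config L
  haveI := YM2.isMulLeftInvariant_haarProbability (Matrix.specialUnitaryGroup (Fin 2) ℂ)
  set π : Measure (GaugeConfig 3 L (Matrix.specialUnitaryGroup (Fin 2) ℂ)) := Measure.pi fun _ : Edge 3 L => haarProbability (Matrix.specialUnitaryGroup (Fin 2) ℂ) with hπ
  haveI : IsProbabilityMeasure π := by rw [hπ]; infer_instance
  set co : (GaugeConfig 3 L (Matrix.specialUnitaryGroup (Fin 2) ℂ)) → (Edge 3 L × Fin (fundamentalLatticeRep 2).N × Fin (fundamentalLatticeRep 2).N × Bool → ℝ) := (fun (V : GaugeConfig 3 L (Matrix.specialUnitaryGroup (Fin 2) ℂ)) (q : Edge 3 L × Fin (fundamentalLatticeRep 2).N × Fin (fundamentalLatticeRep 2).N × Bool) => (fun z : ℂ => if q.2.2.2 then z.im else z.re) ((fundamentalRep (Fin 2) (V q.1) : Matrix (Fin 2) (Fin 2) ℂ) q.2.1 q.2.2.1)) with hco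
  set φX : (Edge 3 L × Fin (fundamentalLatticeRep 2).N × Fin (fundamentalLatticeRep 2).N × Bool → ℝ) → (Edge 3 L × Fin (fundamentalLatticeRep 2).N × Fin (fundamentalLatticeRep 2).N × Bool → ℝ) := fun y => (fun q : Edge 3 L × Fin (fundamentalLatticeRep 2).N × Fin (fundamentalLatticeRep 2).N × Bool => if e = q.1 then (fun z : ℂ => if q.2.2.2 then z.im else z.re) ((X * (fun (ee : Edge 3 L) => Matrix.of fun (i j : Fin (fundamentalLatticeRep 2).N) => ((y (ee, i, j, false) : ℝ) : ℂ) + ((y (ee, i, j, true) : ℝ) : ℂ) * Complex.I) q.1) q.2.1 q.2.2.1) else 0) with hφX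
  set u : ℝ → (GaugeConfig 3 L (Matrix.specialUnitaryGroup (Fin 2) ℂ)) := fun s => Pi.mulSingle e (SUNBakryEmery.expSU (N := 2) (Y := Matrix.of fun i j : Fin 2 => X i j) hX hX0 s) with hu
  set Φ : ℝ → (GaugeConfig 3 L (Matrix.specialUnitaryGroup (Fin 2) ℂ)) → ℝ := fun s V => H (co (u s * V)) with hΦ
  set Φ' : ℝ → (GaugeConfig 3 L (Matrix.specialUnitaryGroup (Fin 2) ℂ)) → ℝ := fun s V => fderiv ℝ H (co (u s * V)) (φX (co (u s * V))) with hΦ'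
  have hHd : Differentiable ℝ H := hH.differentiable (by norm_num)
  -- continuity
  have hco_cont : Continuous co := continuous_coords (L := L)
  obtain ⟨T, hT⟩ := exists_field_clm e X
  have hφX_cont : Continuous φX := by
    have : φX = fun y => T y := funext fun y => (hT y).symm
    rw [this]; exact T.continuous
  have hflow : Continuous fun p : ℝ × (GaugeConfig 3 L (Matrix.specialUnitaryGroup (Fin 2) ℂ)) => u p.1 * p.2 := continuous_leftFlow hX hX0 e
  have hDH : Continuous (fderiv ℝ H) := hH.continuous_fderiv (by norm_num)
  have hΦ'_cont : Continuous fun p : ℝ × (GaugeConfig 3 L (Matrix.specialUnitaryGroup (Fin 2) ℂ)) => Φ' p.1 p.2 :=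
    (hDH.comp (hco_cont.comp hflow)).clm_apply (hφX_cont.comp (hco_cont.comp hflow))
  have hmul : ∀ s, Continuous fun V : (GaugeConfig 3 L (Matrix.specialUnitaryGroup (Fin 2) ℂ)) => u s * V := fun s => continuous_const.mul continuous_id
  have hΦt_cont : ∀ s, Continuous (Φ s) := fun s => hH.continuous.comp (hco_cont.comp (hmul s))
  have hΦ't_cont : ∀ s, Continuous (Φ' s) := fun s =>
    (hDH.comp (hco_cont.comp (hmul s))).clm_apply (hφX_cont.comp (hco_cont.comp (hmul s)))
  -- invariance: `∫ Φ s = ∫ Φ 0`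
  have hu0 : u 0 = 1 := by
    rw [hu]
    have : (SUNBakryEmery.expSU (N := 2) (Y := Matrix.of fun i j : Fin 2 => X i j) hX hX0 (0 : ℝ)) = 1 :=
      Subtype.ext (by rw [SUNBakryEmery.coe_expSU, zero_smul, NormedSpace.exp_zero]; rfl)
    simp only [this, Pi.mulSingle_one]
  have hconst : ∀ s, ∫ V, Φ s V ∂π = ∫ V, Φ 0 V ∂π := by
    intro s
    have h1 : ∀ V, Φ s V = Φ 0 (u s * V) := by intro V; simp only [hΦ, hu0, one_mul]
    simp_rw [h1]
    exact integral_mul_left_eq_self (fun V => Φ 0 V) (u s)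
  -- uniform bound on `[-1,1] × SU(2)^E`
  obtain ⟨C, hC⟩ : ∃ C, ∀ p ∈ (Metric.closedBall (0 : ℝ) 1) ×ˢ (Set.univ : Set (GaugeConfig 3 L (Matrix.specialUnitaryGroup (Fin 2) ℂ))), ‖Φ' p.1 p.2‖ ≤ C :=
    ((isCompact_closedBall (0 : ℝ) 1).prod isCompact_univ).exists_bound_of_continuousOn hΦ'_cont.continuousOn
  -- pointwise derivative along the flow
  have hderiv : ∀ (V : (GaugeConfig 3 L (Matrix.specialUnitaryGroup (Fin 2) ℂ))) (s : ℝ), HasDerivAt (fun s => Φ s V) (Φ' s V) s := fun V s =>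
    hasDerivAt_comp_coords_leftFlow hX hX0 e V hHd s
  have hmain := hasDerivAt_integral_of_dominated_loc_of_deriv_le (μ := π) (F := Φ) (F' := Φ')
    (x₀ := (0 : ℝ)) (s := Metric.ball 0 1) (bound := fun _ => C) (Metric.ball_mem_nhds 0 one_pos)
    (Eventually.of_forall fun s => (hΦt_cont s).aestronglyMeasurable)
    ((hΦt_cont 0).integrable_of_hasCompactSupport (HasCompactSupport.of_compactSpace _))
    (hΦ't_cont 0).aestronglyMeasurable
    (ae_of_all _ fun V s hs => hC (s, V) ⟨Metric.ball_subset_closedBall hs, Set.mem_univ _⟩)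
    (integrable_const C) (ae_of_all _ fun V s _ => hderiv V s)
  have hzero : HasDerivAt (fun s => ∫ V, Φ s V ∂π) 0 0 := by
    have : (fun s => ∫ V, Φ s V ∂π) = fun _ => ∫ V, Φ 0 V ∂π := funext hconst
    rw [this]
    exact hasDerivAt_const _ _
  have heq : ∫ V, Φ' 0 V ∂π = 0 := hmain.2.unique hzero
  have hΦ'0 : ∀ V, Φ' 0 V = fderiv ℝ H (co V) (φX (co V)) := by intro V; simp only [hΦ', hu0, one_mul]
  simp_rw [hΦ'0] at heq
  exact heq

/-! ## §4. Integration by parts for the Wilson measure along the noise fields -/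

/-- The density exponent of `μ_{β'}`: `−β'·S_W(V) = ψ̂(coords V) − 2β'·#𝒫` with `ψ̂ = β' Σ_p Re tr U_p` the plaquette function of
`…GradientDriftFlat` (`S_W = Σ_p (2 − Re tr U_p)`). [folklore] -/
theorem neg_mul_wilsonAction_eq_psiHat (β : ℝ) (V : (GaugeConfig 3 L (Matrix.specialUnitaryGroup (Fin 2) ℂ))) :
    -β * wilsonAction (fundamentalRep (Fin 2)) V =
      (fun y : (Edge 3 L × Fin (fundamentalLatticeRep 2).N × Fin (fundamentalLatticeRep 2).N × Bool → ℝ) => β * ∑ p : Plaquette 3 L, (rootedLoop (fun (ee : Edge 3 L) (i j : Fin (fundamentalLatticeRep 2).N) => ((y (ee, i, j, false) : ℝ) : ℂ) + ((y (ee, i, j, true) : ℝ) : ℂ) * Complex.I) (p.1, p.2.1.1) p.2.1.2 false).trace.re) ((fun (V : GaugeConfig 3 L (Matrix.specialUnitaryGroup (Fin 2) ℂ)) (q : Edge 3 L × Fin (fundamentalLatticeRep 2).N × Fin (fundamentalLatticeRep 2).N × Bool) => (fun z : ℂ => if q.2.2.2 then z.im else z.re) ((fundamentalRep (Fin 2)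 (V q.1) : Matrix (Fin 2) (Fin 2) ℂ) q.2.1 q.2.2.1)) V) - 2 * β * Fintype.card (Plaquette 3 L) := by
  have hreb : (fun (ee : Edge 3 L) (i j : Fin (fundamentalLatticeRep 2).N) => ((((fun (V : GaugeConfig 3 L (Matrix.specialUnitaryGroup (Fin 2) ℂ)) (q : Edge 3 L × Fin (fundamentalLatticeRep 2).N × Fin (fundamentalLatticeRep 2).N × Bool) => (fun z : ℂ => if q.2.2.2 then z.im else z.re) ((fundamentalRep (Fin 2) (V q.1) : Matrix (Fin 2) (Fin 2) ℂ) q.2.1 q.2.2.1)) V) (ee, i, j, false) : ℝ) : ℂ) +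
      ((((fun (V : GaugeConfig 3 L (Matrix.specialUnitaryGroup (Fin 2) ℂ)) (q : Edge 3 L × Fin (fundamentalLatticeRep 2).N × Fin (fundamentalLatticeRep 2).N × Bool) => (fun z : ℂ => if q.2.2.2 then z.im else z.re) ((fundamentalRep (Fin 2) (V q.1) : Matrix (Fin 2) (Fin 2) ℂ) q.2.1 q.2.2.1)) V) (ee, i, j, true) : ℝ) : ℂ) * Complex.I) = matrixConfig (fundamentalRep (Fin 2)) V :=
    rebuild_flat (matrixConfig (fundamentalRep (Fin 2)) V)
  have hp : ∀ p : Plaquette 3 L, (rootedLoop (fun (ee : Edge 3 L) (i j : Fin (fundamentalLatticeRep 2).N) => ((((fun (V : GaugeConfig 3 L (Matrix.specialUnitaryGroup (Fin 2) ℂ)) (q : Edge 3 L × Fin (fundamentalLatticeRep 2).N × Fin (fundamentalLatticeRep 2).N × Bool) => (fun z : ℂ => if q.2.2.2 then z.im else z.re) ((fundamentalRep (Fin 2) (V q.1) : Matrix (Fin 2) (Fin 2) ℂ) q.2.1 q.2.2.1)) V) (ee, i, j, false) : ℝ) : ℂ) +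
      ((((fun (V : GaugeConfig 3 L (Matrix.specialUnitaryGroup (Fin 2) ℂ)) (q : Edge 3 L × Fin (fundamentalLatticeRep 2).N × Fin (fundamentalLatticeRep 2).N × Bool) => (fun z : ℂ => if q.2.2.2 then z.im else z.re) ((fundamentalRep (Fin 2) (V q.1) : Matrix (Fin 2) (Fin 2) ℂ) q.2.1 q.2.2.1)) V) (ee, i, j, true) : ℝ) : ℂ) * Complex.I) (p.1, p.2.1.1) p.2.1.2 false).trace.re =
      ((fundamentalRep (Fin 2)) (plaquetteHolonomy V p.1 p.2.1.1 p.2.1.2)).trace.re := by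
    intro p
    have h3 : rootedLoop (fun (ee : Edge 3 L) (i j : Fin (fundamentalLatticeRep 2).N) => ((((fun (V : GaugeConfig 3 L (Matrix.specialUnitaryGroup (Fin 2) ℂ)) (q : Edge 3 L × Fin (fundamentalLatticeRep 2).N × Fin (fundamentalLatticeRep 2).N × Bool) => (fun z : ℂ => if q.2.2.2 then z.im else z.re) ((fundamentalRep (Fin 2) (V q.1) : Matrix (Fin 2) (Fin 2) ℂ) q.2.1 q.2.2.1)) V) (ee, i, j, false) : ℝ) : ℂ) +
        ((((fun (V : GaugeConfig 3 L (Matrix.specialUnitaryGroup (Fin 2) ℂ)) (q : Edge 3 L × Fin (fundamentalLatticeRep 2).N × Fin (fundamentalLatticeRep 2).N × Bool) => (fun z : ℂ => if q.2.2.2 then z.im else z.re) ((fundamentalRep (Fin 2) (V q.1) : Matrix (Fin 2) (Fin 2) ℂ) q.2.1 q.2.2.1)) V) (ee, i, j, true) : ℝ) : ℂ) * Complex.I) (p.1, p.2.1.1) p.2.1.2 false =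
        (fundamentalRep (Fin 2)) (plaquetteHolonomy V p.1 p.2.1.1 p.2.1.2) := by
      rw [hreb]; exact rootedLoop_matrixConfig_false (fundamentalLatticeRep 2) V (p.1, p.2.1.1) p.2.1.2
    rw [h3]
    rfl
  have hsum : (fun y : (Edge 3 L × Fin (fundamentalLatticeRep 2).N × Fin (fundamentalLatticeRep 2).N × Bool → ℝ) => β * ∑ p : Plaquette 3 L, (rootedLoop (fun (ee : Edge 3 L) (i j : Fin (fundamentalLatticeRep 2).N) => ((y (ee, i, j, false) : ℝ) : ℂ) + ((y (ee, i, j, true) : ℝ) : ℂ) * Complex.I) (p.1, p.2.1.1) p.2.1.2 false).trace.re) ((fun (V : GaugeConfig 3 L (Matrix.specialUnitaryGroup (Fin 2) ℂ)) (q : Edge 3 L × Fin (fundamentalLatticeRep 2).N × Fin (fundamentalLatticeRep 2).N × Bool) => (fun z : ℂ => if q.2.2.2 then z.im else z.re) ((fundamentalRep (Fin 2) (V q.1) : Matrix (Fin 2) (Fin 2) ℂ) q.2.1 q.2.2.1)) V) = β * ∑ p : Plaquette 3 L, ((fundamentalRep (Fin 2)) (plaquetteHolonomy V p.1 p.2.1.1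 p.2.1.2)).trace.re :=
    congrArg (fun t : ℝ => β * t) (Finset.sum_congr rfl fun p _ => hp p)
  rw [hsum, wilsonAction, Finset.mul_sum, Finset.mul_sum]
  rw [show (2 : ℝ) * β * Fintype.card (Plaquette 3 L) = ∑ _p : Plaquette 3 L, 2 * β by
    rw [Finset.sum_const, Finset.card_univ, nsmul_eq_mul]; ring]
  rw [← Finset.sum_sub_distrib]
  refine Finset.sum_congr rfl fun p _ => ?_
  simp only [Nat.cast_ofNat]
  ring

/-- ★★ **Integration by parts along the noise field `σ_n` for the Wilson measure `μ_{β'}`**: for `C¹` functions `A, B` of the real link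
coordinates and every noise index `n = (e, ν)`,
`∫ (W_nA)(coords V) B(coords V) dμ_{β'} = −∫ A (W_nB) dμ_{β'} − ∫ A B (W_nψ̂) dμ_{β'}`,
`W_n f (y) = Df(y)[σ_n(y)]`, `σ_n(y) = coords δ_e(√2 𝐩(E_ν) rebuild(y)_e)`, `ψ̂ = β'Σ_p Re tr U_p` — the hypothesis `hIBP` of
`integral_frameGen_sq_eq`.  (Haar IBP `integral_fieldDeriv_pi_eq_zero` for `H = A·B·e^{ψ̂}` and `μ_{β'} = Z⁻¹e^{ψ̂∘coords}·Haar^{⊗E}`.)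
[folklore] -/
theorem integral_frameDeriv_mul_wilson (L : ℕ) [NeZero L] (β : ℝ) (n : Edge 3 L × NoiseIdx (fundamentalLatticeRep 2).N)
    {A B : (Edge 3 L × Fin (fundamentalLatticeRep 2).N × Fin (fundamentalLatticeRep 2).N × Bool → ℝ) → ℝ} (hA : ContDiff ℝ 1 A) (hB : ContDiff ℝ 1 B) :
    ∫ V, fderiv ℝ A ((fun (V : GaugeConfig 3 L (Matrix.specialUnitaryGroup (Fin 2) ℂ)) (q : Edge 3 L × Fin (fundamentalLatticeRep 2).N × Fin (fundamentalLatticeRep 2).N × Bool) => (fun z : ℂ => if q.2.2.2 then z.im else z.re) ((fundamentalRep (Fin 2) (V q.1) : Matrix (Fin 2) (Fin 2) ℂ) q.2.1 q.2.2.1)) V) (fun q : Edge 3 L × Fin (fundamentalLatticeRep 2).N × Fin (fundamentalLatticeRep 2).N × Bool => if n.1 = q.1 then (fun z : ℂ => if q.2.2.2 then z.im else z.re) (((Real.sqrt 2 : ℂ) • ((fundamentalLatticeRep 2).lieProj (noiseDir n.2) * (fun (ee : Edge 3 L) => Matrix.of fun (i j : Fin (fundamentalLatticeRep 2).N) =>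 (((fun (V : GaugeConfig 3 L (Matrix.specialUnitaryGroup (Fin 2) ℂ)) (q : Edge 3 L × Fin (fundamentalLatticeRep 2).N × Fin (fundamentalLatticeRep 2).N × Bool) => (fun z : ℂ => if q.2.2.2 then z.im else z.re) ((fundamentalRep (Fin 2) (V q.1) : Matrix (Fin 2) (Fin 2) ℂ) q.2.1 q.2.2.1)) V (ee, i, j, false) : ℝ) : ℂ) + (((fun (V : GaugeConfig 3 L (Matrix.specialUnitaryGroup (Fin 2) ℂ)) (q : Edge 3 L × Fin (fundamentalLatticeRep 2).N × Fin (fundamentalLatticeRep 2).N × Bool) => (fun z : ℂ => if q.2.2.2 then z.im else z.re) ((fundamentalRep (Fin 2) (V q.1) : Matrix (Fin 2) (Fin 2) ℂ) q.2.1 q.2.2.1)) V (ee, i, j, true) : ℝ) : ℂ) * Complex.I) q.1)) q.2.1 q.2.2.1) else 0) * B ((fun (V : GaugeConfig 3 L (Matrix.specialUnitaryGroup (Fin 2) ℂ)) (q : Edge 3 L × Fin (fundamentalLatticeRep 2).N × Fin (fundamentalLatticeRep 2).N × Bool) => (fun z : ℂ => if q.2.2.2 then z.im else z.re) ((fundamentalRep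 (Fin 2) (V q.1) : Matrix (Fin 2) (Fin 2) ℂ) q.2.1 q.2.2.1)) V)
        ∂(wilsonMeasure (d := 3) (L := L) (fundamentalRep (Fin 2)) β) =
      -∫ V, A ((fun (V : GaugeConfig 3 L (Matrix.specialUnitaryGroup (Fin 2) ℂ)) (q : Edge 3 L × Fin (fundamentalLatticeRep 2).N × Fin (fundamentalLatticeRep 2).N × Bool) => (fun z : ℂ => if q.2.2.2 then z.im else z.re) ((fundamentalRep (Fin 2) (V q.1) : Matrix (Fin 2) (Fin 2) ℂ) q.2.1 q.2.2.1)) V) * fderiv ℝ B ((fun (V : GaugeConfig 3 L (Matrix.specialUnitaryGroup (Fin 2) ℂ)) (q : Edge 3 L × Fin (fundamentalLatticeRep 2).N × Fin (fundamentalLatticeRep 2).N × Bool) => (fun z : ℂ => if q.2.2.2 then z.im else z.re) ((fundamentalRep (Fin 2) (V q.1) : Matrix (Fin 2) (Fin 2) ℂ) q.2.1 q.2.2.1)) V) (fun q : Edge 3 L × Fin (fundamentalLatticeRep 2).N × Fin (fundamentalLatticeRep 2).N × Bool => if n.1 = q.1 then (fun z : ℂ => if q.2.2.2 then z.im else z.re)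 (((Real.sqrt 2 : ℂ) • ((fundamentalLatticeRep 2).lieProj (noiseDir n.2) * (fun (ee : Edge 3 L) => Matrix.of fun (i j : Fin (fundamentalLatticeRep 2).N) => (((fun (V : GaugeConfig 3 L (Matrix.specialUnitaryGroup (Fin 2) ℂ)) (q : Edge 3 L × Fin (fundamentalLatticeRep 2).N × Fin (fundamentalLatticeRep 2).N × Bool) => (fun z : ℂ => if q.2.2.2 then z.im else z.re) ((fundamentalRep (Fin 2) (V q.1) : Matrix (Fin 2) (Fin 2) ℂ) q.2.1 q.2.2.1)) V (ee, i, j, false) : ℝ) : ℂ) + (((fun (V : GaugeConfig 3 L (Matrix.specialUnitaryGroup (Fin 2) ℂ)) (q : Edge 3 L × Fin (fundamentalLatticeRep 2).N × Fin (fundamentalLatticeRep 2).N × Bool) => (fun z : ℂ => if q.2.2.2 then z.im else z.re) ((fundamentalRep (Fin 2) (V q.1) : Matrix (Fin 2) (Fin 2) ℂ) q.2.1 q.2.2.1)) V (ee, i, j, true) : ℝ) : ℂ) * Complex.I) q.1)) q.2.1 q.2.2.1) else 0)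
          ∂(wilsonMeasure (d := 3) (L := L) (fundamentalRep (Fin 2)) β) -
        ∫ V, A ((fun (V : GaugeConfig 3 L (Matrix.specialUnitaryGroup (Fin 2) ℂ)) (q : Edge 3 L × Fin (fundamentalLatticeRep 2).N × Fin (fundamentalLatticeRep 2).N × Bool) => (fun z : ℂ => if q.2.2.2 then z.im else z.re) ((fundamentalRep (Fin 2) (V q.1) : Matrix (Fin 2) (Fin 2) ℂ) q.2.1 q.2.2.1)) V) * B ((fun (V : GaugeConfig 3 L (Matrix.specialUnitaryGroup (Fin 2) ℂ)) (q : Edge 3 L × Fin (fundamentalLatticeRep 2).N × Fin (fundamentalLatticeRep 2).N × Bool) => (fun z : ℂ => if q.2.2.2 then z.im else z.re) ((fundamentalRep (Fin 2) (V q.1) : Matrix (Fin 2) (Fin 2) ℂ) q.2.1 q.2.2.1)) V) * fderiv ℝ (fun y : (Edge 3 L × Fin (fundamentalLatticeRep 2).N × Fin (fundamentalLatticeRep 2).N × Bool → ℝ) => β * ∑ p : Plaquette 3 L, (rootedLoop (fun (ee : Edge 3 L) (i j : Fin (fundamentalLatticeRep 2).N) => ((y (ee, i, j, false) : ℝ)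 : ℂ) + ((y (ee, i, j, true) : ℝ) : ℂ) * Complex.I) (p.1, p.2.1.1) p.2.1.2 false).trace.re) ((fun (V : GaugeConfig 3 L (Matrix.specialUnitaryGroup (Fin 2) ℂ)) (q : Edge 3 L × Fin (fundamentalLatticeRep 2).N × Fin (fundamentalLatticeRep 2).N × Bool) => (fun z : ℂ => if q.2.2.2 then z.im else z.re) ((fundamentalRep (Fin 2) (V q.1) : Matrix (Fin 2) (Fin 2) ℂ) q.2.1 q.2.2.1)) V) (fun q : Edge 3 L × Fin (fundamentalLatticeRep 2).N × Fin (fundamentalLatticeRep 2).N × Bool => if n.1 = q.1 then (fun z : ℂ => if q.2.2.2 then z.im else z.re) (((Real.sqrt 2 : ℂ) • ((fundamentalLatticeRep 2).lieProj (noiseDir n.2) * (fun (ee : Edge 3 L) => Matrix.of fun (i j : Fin (fundamentalLatticeRep 2).N) => (((fun (V : GaugeConfig 3 L (Matrix.specialUnitaryGroup (Fin 2) ℂ)) (q : Edge 3 L × Fin (fundamentalLatticeRep 2).N × Fin (fundamentalLatticeRep 2).N × Bool) => (fun z : ℂ => if q.2.2.2 then z.im else z.re) ((fundamentalRep (Fin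 2) (V q.1) : Matrix (Fin 2) (Fin 2) ℂ) q.2.1 q.2.2.1)) V (ee, i, j, false) : ℝ) : ℂ) + (((fun (V : GaugeConfig 3 L (Matrix.specialUnitaryGroup (Fin 2) ℂ)) (q : Edge 3 L × Fin (fundamentalLatticeRep 2).N × Fin (fundamentalLatticeRep 2).N × Bool) => (fun z : ℂ => if q.2.2.2 then z.im else z.re) ((fundamentalRep (Fin 2) (V q.1) : Matrix (Fin 2) (Fin 2) ℂ) q.2.1 q.2.2.1)) V (ee, i, j, true) : ℝ) : ℂ) * Complex.I) q.1)) q.2.1 q.2.2.1) else 0)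
          ∂(wilsonMeasure (d := 3) (L := L) (fundamentalRep (Fin 2)) β) := by
  classical
  haveI := secondCountableTopology_su2
  haveI := borelSpace_config L
  set π : Measure (GaugeConfig 3 L (Matrix.specialUnitaryGroup (Fin 2) ℂ)) := Measure.pi fun _ : Edge 3 L => haarProbability (Matrix.specialUnitaryGroup (Fin 2) ℂ) with hπ
  haveI : IsProbabilityMeasure π := by rw [hπ]; infer_instance
  set μ : Measure (GaugeConfig 3 L (Matrix.specialUnitaryGroup (Fin 2) ℂ)) := wilsonMeasure (d := 3) (L := L) (fundamentalRep (Fin 2)) β with hμ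
  set co : (GaugeConfig 3 L (Matrix.specialUnitaryGroup (Fin 2) ℂ)) → (Edge 3 L × Fin (fundamentalLatticeRep 2).N × Fin (fundamentalLatticeRep 2).N × Bool → ℝ) := (fun (V : GaugeConfig 3 L (Matrix.specialUnitaryGroup (Fin 2) ℂ)) (q : Edge 3 L × Fin (fundamentalLatticeRep 2).N × Fin (fundamentalLatticeRep 2).N × Bool) => (fun z : ℂ => if q.2.2.2 then z.im else z.re) ((fundamentalRep (Fin 2) (V q.1) : Matrix (Fin 2) (Fin 2) ℂ) q.2.1 q.2.2.1)) with hco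
  set ψ : (Edge 3 L × Fin (fundamentalLatticeRep 2).N × Fin (fundamentalLatticeRep 2).N × Bool → ℝ) → ℝ := (fun y : (Edge 3 L × Fin (fundamentalLatticeRep 2).N × Fin (fundamentalLatticeRep 2).N × Bool → ℝ) => β * ∑ p : Plaquette 3 L, (rootedLoop (fun (ee : Edge 3 L) (i j : Fin (fundamentalLatticeRep 2).N) => ((y (ee, i, j, false) : ℝ) : ℂ) + ((y (ee, i, j, true) : ℝ) : ℂ) * Complex.I) (p.1, p.2.1.1) p.2.1.2 false).trace.re) with hψ
  -- the field `σ_n` is the field `δ_e(X Q_e)` with `X = √2 P_ν`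
  set X : Matrix (Fin (fundamentalLatticeRep 2).N) (Fin (fundamentalLatticeRep 2).N) ℂ := (Real.sqrt 2 : ℂ) • (fundamentalLatticeRep 2).lieProj (noiseDir n.2) with hXdef
  have hX : Xᴴ = -X := by
    rw [hXdef, Matrix.conjTranspose_smul, ← Matrix.star_eq_conjTranspose, (fundamentalLatticeRep 2).star_lieProj, Complex.star_def,
      Complex.conj_ofReal, smul_neg]
  have hX0 : X.trace = 0 := by
    rw [hXdef, Matrix.trace_smul, trace_eq_zero_of_mem_lieAlg_two ((fundamentalLatticeRep 2).lieProj_mem (noiseDir n.2)), smul_zero]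
  set σ : (Edge 3 L × Fin (fundamentalLatticeRep 2).N × Fin (fundamentalLatticeRep 2).N × Bool → ℝ) → (Edge 3 L × Fin (fundamentalLatticeRep 2).N × Fin (fundamentalLatticeRep 2).N × Bool → ℝ) := fun y => (fun q : Edge 3 L × Fin (fundamentalLatticeRep 2).N × Fin (fundamentalLatticeRep 2).N × Bool => if n.1 = q.1 then (fun z : ℂ => if q.2.2.2 then z.im else z.re) (((Real.sqrt 2 : ℂ) • ((fundamentalLatticeRep 2).lieProj (noiseDir n.2) * (fun (ee : Edge 3 L) => Matrix.of fun (i j : Fin (fundamentalLatticeRep 2).N) => ((y (ee, i, j, false) : ℝ) : ℂ) + ((y (ee, i, j, true) : ℝ) : ℂ) * Complex.I) q.1)) q.2.1 q.2.2.1) else 0) with hσ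
  have hσX : ∀ y, σ y = (fun q : Edge 3 L × Fin (fundamentalLatticeRep 2).N × Fin (fundamentalLatticeRep 2).N × Bool => if n.1 = q.1 then (fun z : ℂ => if q.2.2.2 then z.im else z.re) ((X * (fun (ee : Edge 3 L) => Matrix.of fun (i j : Fin (fundamentalLatticeRep 2).N) => ((y (ee, i, j, false) : ℝ) : ℂ) + ((y (ee, i, j, true) : ℝ) : ℂ) * Complex.I) q.1) q.2.1 q.2.2.1) else 0) := by
    intro y; funext q; simp only [hσ, hXdef, Matrix.smul_mul]
  -- tilted form of `μ`
  have hψC : ContDiff ℝ 1 ψ := (contDiff_psiHat (d := 3) (L := L) (N := (fundamentalLatticeRep 2).N) β).of_le le_top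
  have htilt : μ = π.tilted (fun V => -β * wilsonAction (fundamentalRep (Fin 2)) V) :=
    Literature.MathematicalPhysics.QuantumLattice.wilsonMeasure_eq_tilted_pi (fundamentalRep (Fin 2))
      (continuous_fundamentalRep (n := Fin 2)) β
  have hdens : ∀ V, -β * wilsonAction (fundamentalRep (Fin 2)) V = ψ (co V) - 2 * β * Fintype.card (Plaquette 3 L) :=
    fun V => neg_mul_wilsonAction_eq_psiHat β V
  -- the product `H = A·B·e^ψ` and its frame derivative
  set H : (Edge 3 L × Fin (fundamentalLatticeRep 2).N × Fin (fundamentalLatticeRep 2).N × Bool → ℝ) → ℝ := fun y => A y * B y * Real.exp (ψ y) with hH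
  have hHC : ContDiff ℝ 1 H := (hA.mul hB).mul (hψC.exp)
  have hAd : Differentiable ℝ A := hA.differentiable (by norm_num)
  have hBd : Differentiable ℝ B := hB.differentiable (by norm_num)
  have hψd : Differentiable ℝ ψ := hψC.differentiable (by norm_num)
  have hWH : ∀ y v, fderiv ℝ H y v = Real.exp (ψ y) *
      (fderiv ℝ A y v * B y + A y * fderiv ℝ B y v + A y * B y * fderiv ℝ ψ y v) := by
    intro y v
    have h1 : DifferentiableAt ℝ (fun z => A z * B z) y := (hAd y).mul (hBd y)
    have h2 : DifferentiableAt ℝ (fun z => Real.exp (ψ z)) y := (hψd y).exp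
    rw [hH, fderiv_mul_apply_dir h1 h2, fderiv_mul_apply_dir (hAd y) (hBd y), frameDeriv_exp (hψd y)]
    ring
  -- Haar integration by parts for `H`, in the `σ` notation
  have hIBP0 : ∫ V, fderiv ℝ H (co V) (σ (co V)) ∂π = 0 := by
    have hfun : (fun V : (GaugeConfig 3 L (Matrix.specialUnitaryGroup (Fin 2) ℂ)) => fderiv ℝ H (co V) (σ (co V))) =
        fun V => fderiv ℝ H (co V) (fun q : Edge 3 L × Fin (fundamentalLatticeRep 2).N × Fin (fundamentalLatticeRep 2).N × Bool => if n.1 = q.1 then (fun z : ℂ => if q.2.2.2 then z.im else z.re) ((X * (fun (ee : Edge 3 L) => Matrix.of fun (i j : Fin (fundamentalLatticeRep 2).N) => (((co V) (ee, i, j, false) : ℝ) : ℂ) + (((co V) (ee, i, j, true) : ℝ) : ℂ) * Complex.I) q.1) q.2.1 q.2.2.1) else 0) := funext fun V => by rw [hσX]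
    rw [hfun]
    exact integral_fieldDeriv_pi_eq_zero L hX hX0 n.1 hHC
  -- continuity of the integrands
  have hco_cont : Continuous co := continuous_coords (L := L)
  obtain ⟨T, hT⟩ := exists_field_clm n.1 X
  have hσ_cont : Continuous σ := by
    have : σ = fun y => T y := funext fun y => by rw [hσX, hT]
    rw [this]; exact T.continuous
  have hWA : Continuous fun y => fderiv ℝ A y (σ y) := (hA.continuous_fderiv (by norm_num)).clm_apply hσ_cont
  have hWB : Continuous fun y => fderiv ℝ B y (σ y) := (hB.continuous_fderiv (by norm_num)).clm_apply hσ_cont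
  have hWψ : Continuous fun y => fderiv ℝ ψ y (σ y) := (hψC.continuous_fderiv (by norm_num)).clm_apply hσ_cont
  have hWHc : Continuous fun y => fderiv ℝ H y (σ y) := (hHC.continuous_fderiv (by norm_num)).clm_apply hσ_cont
  have hg1 : Continuous fun V : (GaugeConfig 3 L (Matrix.specialUnitaryGroup (Fin 2) ℂ)) => fderiv ℝ A (co V) (σ (co V)) * B (co V) :=
    (hWA.comp hco_cont).mul (hB.continuous.comp hco_cont)
  have hg2 : Continuous fun V : (GaugeConfig 3 L (Matrix.specialUnitaryGroup (Fin 2) ℂ)) => A (co V) * fderiv ℝ B (co V) (σ (co V)) :=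
    (hA.continuous.comp hco_cont).mul (hWB.comp hco_cont)
  have hg3 : Continuous fun V : (GaugeConfig 3 L (Matrix.specialUnitaryGroup (Fin 2) ℂ)) => A (co V) * B (co V) * fderiv ℝ ψ (co V) (σ (co V)) :=
    ((hA.continuous.comp hco_cont).mul (hB.continuous.comp hco_cont)).mul (hWψ.comp hco_cont)
  -- the density
  set Z : ℝ := ∫ V, Real.exp (-β * wilsonAction (fundamentalRep (Fin 2)) V) ∂π with hZ
  have hdens_cont : Continuous fun V : (GaugeConfig 3 L (Matrix.specialUnitaryGroup (Fin 2) ℂ)) => Real.exp (-β * wilsonAction (fundamentalRep (Fin 2)) V) := by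
    have h1 : (fun V : (GaugeConfig 3 L (Matrix.specialUnitaryGroup (Fin 2) ℂ)) => Real.exp (-β * wilsonAction (fundamentalRep (Fin 2)) V)) =
        fun V => Real.exp (ψ (co V) - 2 * β * Fintype.card (Plaquette 3 L)) := funext fun V => by rw [hdens]
    rw [h1]
    exact ((hψC.continuous.comp hco_cont).sub continuous_const).rexp
  have hμπ : ∀ g : (GaugeConfig 3 L (Matrix.specialUnitaryGroup (Fin 2) ℂ)) → ℝ, ∫ V, g V ∂μ = ∫ V, (Real.exp (-β * wilsonAction (fundamentalRep (Fin 2)) V) / Z) * g V ∂π := by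
    intro g
    rw [htilt, integral_tilted]
    rfl
  have hint : ∀ g : (GaugeConfig 3 L (Matrix.specialUnitaryGroup (Fin 2) ℂ)) → ℝ, Continuous g →
      Integrable (fun V => (Real.exp (-β * wilsonAction (fundamentalRep (Fin 2)) V) / Z) * g V) π := fun g hg =>
    ((hdens_cont.div_const Z).mul hg).integrable_of_hasCompactSupport (HasCompactSupport.of_compactSpace _)
  -- restate the goal in the abbreviations and sum the three integrals
  show ∫ V, fderiv ℝ A (co V) (σ (co V)) * B (co V) ∂μ =
    -∫ V, A (co V) * fderiv ℝ B (co V) (σ (co V)) ∂μ - ∫ V, A (co V) * B (co V) * fderiv ℝ ψ (co V) (σ (co V)) ∂μ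
  have hsum : ∫ V, fderiv ℝ A (co V) (σ (co V)) * B (co V) ∂μ + ∫ V, A (co V) * fderiv ℝ B (co V) (σ (co V)) ∂μ +
      ∫ V, A (co V) * B (co V) * fderiv ℝ ψ (co V) (σ (co V)) ∂μ =
      ∫ V, (Real.exp (-(2 * β * Fintype.card (Plaquette 3 L))) / Z) * fderiv ℝ H (co V) (σ (co V)) ∂π := by
    have h12 : Integrable (fun V : (GaugeConfig 3 L (Matrix.specialUnitaryGroup (Fin 2) ℂ)) =>
        Real.exp (-β * wilsonAction (fundamentalRep (Fin 2)) V) / Z * (fderiv ℝ A (co V) (σ (co V)) * B (co V)) +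
        Real.exp (-β * wilsonAction (fundamentalRep (Fin 2)) V) / Z * (A (co V) * fderiv ℝ B (co V) (σ (co V)))) π :=
      (hint _ hg1).add (hint _ hg2)
    rw [hμπ, hμπ, hμπ, ← integral_add (hint _ hg1) (hint _ hg2), ← integral_add h12 (hint _ hg3)]
    refine integral_congr_ae (Eventually.of_forall fun V => ?_)
    beta_reduce
    rw [hWH, hdens, Real.exp_sub, Real.exp_neg]
    field_simp
  have hzero : ∫ V, (Real.exp (-(2 * β * Fintype.card (Plaquette 3 L))) / Z) * fderiv ℝ H (co V) (σ (co V)) ∂π = 0 := by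
    rw [integral_const_mul, hIBP0, mul_zero]
  rw [hzero] at hsum
  linarith

end Summit.QuantumFields.YangMills.Theorems.ColdStartUniversality
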